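import Summits.QuantumFields.BalabanUV.T4Continuum.Support.BlockPairingGeometry
import Literature.MathematicalPhysics.QuantumFieldTheory.Balaban1983to89.B5Blocks16

/-!
# T⁴ programme, spine node NE2 (U1a), tier B row B3.b — THE PAIRING IDENTITY for Bałaban's (1.18) averaging against
# King's injection: `√(L^d)·Q_{L·n} J_L = Q_n·(1 + c_L(S_1 − 1))`, `c_L = (L − 1)/(2L)` (exact, position space)

NE2 formalisation swarm `b2b-balaban-t4-ne2-formalise-*`, seat leaf-06, row B3.b-conc of `t4/SKELETON-NE2-P1.md` v0.2 /
trigger `t4/T4-NE2-TRIGGER.json` (file 1 of 2; file 2 = `Support/LineAveragingPairingLaw`).  The row owner's abstract GRAM SHAPE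
of the catalogue (`Support/GramPerturbationLaw`, journal l.5387 (B)) reduces the `aQ_k(U)ᴴQ_k(U) − aQ_kᴴQ_k` summand of
[Balaban1985BackgroundPropagators] (3.26) p.395 «Δ_a = Δ + DRD* + Q*aQ» to norm data of the transport error AND ONE FREE
INNER-PAIRING LAW `(b, f)` of Bałaban's own `k`-fold averaging `B_k`: `‖B_k‖ ≤ b` and `‖(B_{k+1}J_k − B_k)D_k⁻¹‖ ≤ f_k`
(two adjacent spacings, King's pairing `J_k = JpcT k`, free propagator `D_k⁻¹ = (Δ_a^{(k)})⁻¹`).  For KING's componentwise block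
average the pairing is EXACT (`KingPairingPlantedLaw.sqrt_smul_Qlev_mul_JpcT`: `√(L^d)·Q_L J_L = 1`); for BAŁABAN's (1.18) average
— block average of STRAIGHT-CONTOUR sums «(Q_kA)_b = Σ_{x∈B^k(b₋)} η^{d+1}A([x, x(b)])» (tree: `B5Block118.QvOp`) — it is NOT,
and this file computes the defect EXACTLY:

 * §0 three counting lemmas: `mod_mul_div` (`⌊((LA + ρ) mod LB)/L⌋ = A mod B`, the two tori wrap compatibly), the TENT COUNT
   `tent_count` (`Σ_{ρ<L}Σ_{t<Ln} F(⌊(ρ+t)/L⌋) = L²Σ_{s<n}F(s) + (Σ_{ρ<L}ρ)·(F(n) − F(0))`: refining a straight contour of `n`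
   coarse bonds into `L·n` fine bonds started at the `L` fine offsets weighs every coarse bond `L²` times, up to a transfer of
   weight `L(L−1)/2` from the FIRST bond to the bond AFTER the contour), and `sum_fun_coord` (sums over `[0,L)^d` of a function of
   one coordinate);
 * §1 two levels `n ← L·n` of the torus of periods `M`: the offset glue `(j, r) ↦ L·j + r` (`glue`, a bijection `[0,n)^d × [0,L)^d ≃
   [0,Ln)^d`, `sum_glue`), and **`par_bpt_glue_add_tstep`**: the `L`-block PARENT (`BalabanAveragedTowerModes.par`, [King1986]
   (2.10)) of the fine point `(Ln)y + Lj + r + t e_μ` — `t` fine steps along the contour — is `ny + j + ⌊(r_μ + t)/L⌋e_μ`, for EVERY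
   `t ∈ ℕ`; `JK_mulVec` (King's injection plants piecewise-constantly), `shiftT_mulVec`, `lineSum_shiftT_sub` (the contour sum of
   `S_1f − f` telescopes to the contour's ends, cf. (1.20));
 * §2 **`sqrt_smul_QvOp_mul_JK`**: `√(L^d)·(QvOp (L·n) M * JK n L M) = QvOp n M * (1 + cL L • (shiftT 1 − 1))` with
   `cL L = (Σ_{ρ<L} ρ)/L²`, **`cL_eq`** `= (L−1)/(2L)`, **`norm_cL_le`** `≤ ½`; `(S_1 f)(x, μ) = f(x + e_μ, μ)` is the own-direction
   translation `BalabanLineAverage.shiftT 1`.  File 2 turns this into `‖B_k‖ ≤ 1`, `B_{k+1}J_k − B_k = c_L·B_k(S_1 − 1)` and the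
   SANDWICHED law `‖(B_{k+1}J_k − B_k)(Δ_a^{(k)})⁻¹‖ ≤ ½·d·Cst·L^{−k}` from (1.89) alone.

HONEST FRAMING (T4-DAG p. 1).  `U = 1`, FIXED finite torus, exact lattice combinatorics plus (in file 2) the tree's (1.89); the
statements, the pairing and the constant `c_L` are OURS ([folklore]) — Bałaban prints no such identity; the `[cite:]` tags locate
the printed OBJECTS ((1.6), (1.18), (1.20), King's (2.10)).  This is ONE input of ONE row of tier B of the cell's NE2 skeleton: NOT
[B9] (3.26) as printed, NOT NE2, no background field, no conditional of the cell used; NOT infinite volume, NOT a mass gap, NOT Clay,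
NOT summit progress; spine 0/9 unchanged.  HONEST DEPENDENCY: continuum YM on T⁴ ⇐ BetaPertH ∧ nine spine estimates (0/9 proved);
BetaPertH ⇐ (D1) ∧ (D4) ∧ CAP+tail; G-an2-4 gates asym, D1 and NE2/3/4.  ABSOLUTE RULE kept (inputs = kernel-proved tree modules
only); no `sorry`.
-/

noncomputable section

open scoped BigOperators ComplexConjugate Matrix Matrix.Norms.L2Operator
open Finset

namespace Summit.QuantumFields.BalabanUV.T4Continuum.LineAveragingPairing

open Literature.MathematicalPhysics.QuantumFieldTheory.Balaban1983to89.B5Prop11Plancherel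
open Literature.MathematicalPhysics.QuantumFieldTheory.Balaban1983to89.B5Block118
open Literature.MathematicalPhysics.QuantumFieldTheory.Balaban1983to89.B5Blocks16 (bpt_eq_natCast)
open Summit.QuantumFields.BalabanUV.T4Continuum.BalabanAveragedTowerModes (par)
open Summit.QuantumFields.BalabanUV.T4Continuum.BalabanLineAverage (shiftT)
open Summit.QuantumFields.BalabanUV.T4Continuum.KingPairingPlantedLaw (JK)
open Summit.QuantumFields.BalabanUV.T4Continuum.BlockPairingGeometry (parT JK_apply)

variable {d : ℕ}

/-! ## §0 Three counting lemmas -/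

section Counting

/-- `((L·A + ρ) mod (L·B)) / L = A mod B` for `ρ < L`: integer division by `L` commutes with the two wrap-arounds.
[folklore] -/
theorem mod_mul_div (L A ρ B : ℕ) (hL : 0 < L) (hB : 0 < B) (hρ : ρ < L) :
    (L * A + ρ) % (L * B) / L = A % B := by
  have key : L * A + ρ = (L * (A % B) + ρ) + L * B * (A / B) := by
    conv_lhs => rw [← Nat.div_add_mod A B]
    ring
  have hlt : L * (A % B) + ρ < L * B := by
    have h1 : A % B + 1 ≤ B := Nat.mod_lt A hB
    calc L * (A % B) + ρ < L * (A % B) + L := by omega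
      _ = L * (A % B + 1) := by ring
      _ ≤ L * B := Nat.mul_le_mul_left L h1
  rw [key, Nat.add_mul_mod_self_left, Nat.mod_eq_of_lt hlt, Nat.mul_add_div hL, Nat.div_eq_of_lt hρ, add_zero]

/-- shifted window of a tent count: `Σ_{t<L·n} g(ρ + t) = Σ_{u<L·n} g u + Σ_{i<ρ} g(L·n + i) − Σ_{u<ρ} g u`. [folklore] -/
theorem sum_range_shift {β : Type*} [AddCommGroup β] (g : ℕ → β) (m ρ : ℕ) :
    ∑ t ∈ range m, g (ρ + t) = ∑ u ∈ range m, g u + ∑ i ∈ range ρ, g (m + i) - ∑ u ∈ range ρ, g u := by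
  have h1 : ∑ u ∈ range (ρ + m), g u = ∑ u ∈ range ρ, g u + ∑ t ∈ range m, g (ρ + t) := sum_range_add g ρ m
  have h2 : ∑ u ∈ range (m + ρ), g u = ∑ u ∈ range m, g u + ∑ i ∈ range ρ, g (m + i) := sum_range_add g m ρ
  rw [add_comm ρ m, h2] at h1
  rw [← sub_eq_iff_eq_add'] at h1
  rw [← h1]

/-- **the tent count**: for `F : ℕ → β`,
`Σ_{ρ<L} Σ_{t<L·n} F((ρ + t) / L) = L²·Σ_{s<n} F(s) + (Σ_{ρ<L} ρ)·(F(n) − F(0))` — averaging a piecewise-constant extension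
over the `L`-REFINED straight contour weighs the `n` coarse bonds by `L²` each, except for a boundary transfer of weight
`L(L−1)/2` from the first coarse bond to the one AFTER the contour. [folklore] -/
theorem tent_count (F : ℕ → ℂ) (L n : ℕ) (hL : 0 < L) :
    ∑ ρ ∈ range L, ∑ t ∈ range (L * n), F ((ρ + t) / L)
      = (L : ℂ) ^ 2 * ∑ s ∈ range n, F s + (∑ ρ ∈ range L, (ρ : ℂ)) * (F n - F 0) := by
  have hfull : ∑ u ∈ range (L * n), F (u / L) = (L : ℂ) * ∑ s ∈ range n, F s := by
    induction n with
    | zero => simp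
    | succ n ih =>
      rw [Nat.mul_succ, sum_range_add, ih, sum_range_succ, mul_add]
      congr 1
      have : ∀ i ∈ range L, F ((L * n + i) / L) = F n := by
        intro i hi
        rw [Nat.mul_add_div hL, Nat.div_eq_of_lt (mem_range.mp hi), add_zero]
      rw [sum_congr rfl this, sum_const, card_range, nsmul_eq_mul]
  have hrow : ∀ ρ ∈ range L, ∑ t ∈ range (L * n), F ((ρ + t) / L)
      = (L : ℂ) * ∑ s ∈ range n, F s + (ρ : ℂ) * (F n - F 0) := by
    intro ρ hρ
    have hρL : ρ < L := mem_range.mp hρ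
    rw [sum_range_shift (fun u => F (u / L)) (L * n) ρ, hfull]
    have hA : ∀ i ∈ range ρ, F ((L * n + i) / L) = F n := by
      intro i hi
      rw [Nat.mul_add_div hL, Nat.div_eq_of_lt (lt_trans (mem_range.mp hi) hρL), add_zero]
    have hB : ∀ u ∈ range ρ, F (u / L) = F 0 := by
      intro u hu
      rw [Nat.div_eq_of_lt (lt_trans (mem_range.mp hu) hρL)]
    rw [sum_congr rfl hA, sum_congr rfl hB, sum_const, sum_const, card_range, nsmul_eq_mul, nsmul_eq_mul]
    ring
  rw [sum_congr rfl hrow, sum_add_distrib, ← sum_mul, ← sum_mul, sum_const, card_range, nsmul_eq_mul]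
  ring

/-- sums over offset vectors `r ∈ [0,L)^d` of a function of ONE coordinate `r_μ`: each value is taken `L^{d−1}` times,
written without subtraction as `L · Σ_r φ(r_μ) = L^d · Σ_ρ φ(ρ)`. [folklore] -/
theorem sum_fun_coord (L : ℕ) (μ : Fin d) (φ : Fin L → ℂ) :
    (L : ℂ) * ∑ r : Fin d → Fin L, φ (r μ) = (L : ℂ) ^ d * ∑ ρ : Fin L, φ ρ := by
  classical
  rw [← (Equiv.funSplitAt μ (Fin L)).symm.sum_comp (fun r : Fin d → Fin L => φ (r μ))]
  have h : ∀ p : Fin L × ({j : Fin d // j ≠ μ} → Fin L), φ (((Equiv.funSplitAt μ (Fin L)).symm p) μ) = φ p.1 := by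
    intro p
    congr 1
    simp [Equiv.funSplitAt, Equiv.piSplitAt]
  simp_rw [h]
  rw [Fintype.sum_prod_type]
  simp only [sum_const, card_univ, Fintype.card_fun, Fintype.card_fin, nsmul_eq_mul]
  have hcard : Fintype.card {j : Fin d // j ≠ μ} + 1 = d := by
    rw [Fintype.card_subtype_compl, Fintype.card_fin, Fintype.card_subtype_eq]
    have : 1 ≤ d := Nat.succ_le_of_lt (Fin.pos μ)
    omega
  rw [← Finset.mul_sum, ← mul_assoc,
    show (L : ℂ) ^ d = (L : ℂ) ^ (Fintype.card {j : Fin d // j ≠ μ} + 1) by rw [hcard]]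
  push_cast
  ring

end Counting

/-! ## §1 Two levels `n ← L·n`: block offsets glue, and the PARENT of a point of a refined straight contour -/

section TwoLevels

variable (n L : ℕ) [NeZero n] [NeZero L] (M : Fin d → ℕ) [hM : ∀ μ, NeZero (M μ)]

/-- glue a coarse block offset `j ∈ [0,n)^d` and a fine offset `r ∈ [0,L)^d` into the offset `L·j + r ∈ [0,L·n)^d` of the
`L·n`-block. [folklore] -/
def glue (p : (Fin d → Fin n) × (Fin d → Fin L)) : Fin d → Fin (L * n) :=
  fun ν => ⟨L * (p.1 ν : ℕ) + (p.2 ν : ℕ), by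
    have h1 : (p.1 ν : ℕ) + 1 ≤ n := (p.1 ν).isLt
    have h2 : (p.2 ν : ℕ) < L := (p.2 ν).isLt
    calc L * (p.1 ν : ℕ) + (p.2 ν : ℕ) < L * (p.1 ν : ℕ) + L := by omega
      _ = L * ((p.1 ν : ℕ) + 1) := by ring
      _ ≤ L * n := Nat.mul_le_mul_left L h1⟩

omit [NeZero n] [NeZero L] in
/-- the value of a glued offset. [folklore] -/
theorem glue_val (p : (Fin d → Fin n) × (Fin d → Fin L)) (ν : Fin d) : (glue n L p ν : ℕ) = L * (p.1 ν : ℕ) + (p.2 ν : ℕ) := rfl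

omit [NeZero n] in
/-- `(j, r) ↦ L·j + r` is a bijection `[0,n)^d × [0,L)^d ≃ [0,L·n)^d` (Euclidean division by `L`). [folklore] -/
theorem glue_bijective : Function.Bijective (glue (d := d) n L) := by
  have hL : 0 < L := Nat.pos_of_ne_zero (NeZero.ne L)
  constructor
  · rintro ⟨j, r⟩ ⟨j', r'⟩ h
    have hν : ∀ ν, (j ν : ℕ) = j' ν ∧ (r ν : ℕ) = r' ν := by
      intro ν
      have hv : L * (j ν : ℕ) + r ν = L * (j' ν : ℕ) + r' ν := by
        have h' := congrArg (fun f : Fin d → Fin (L * n) => (f ν : ℕ)) h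
        simpa only [glue_val] using h'
      have hmod := congrArg (· % L) hv
      have hdiv := congrArg (· / L) hv
      simp only [Nat.mul_add_mod, Nat.mod_eq_of_lt (r ν).isLt, Nat.mod_eq_of_lt (r' ν).isLt] at hmod
      simp only [Nat.mul_add_div hL, Nat.div_eq_of_lt (r ν).isLt, Nat.div_eq_of_lt (r' ν).isLt, add_zero] at hdiv
      exact ⟨hdiv, hmod⟩
    exact Prod.ext (funext fun ν => Fin.ext (hν ν).1) (funext fun ν => Fin.ext (hν ν).2)
  · intro j'
    refine ⟨(fun ν => ⟨(j' ν : ℕ) / L, Nat.div_lt_of_lt_mul (j' ν).isLt⟩, fun ν => ⟨(j' ν : ℕ) % L, Nat.mod_lt _ hL⟩), ?_⟩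
    funext ν
    apply Fin.ext
    rw [glue_val]
    exact Nat.div_add_mod (j' ν : ℕ) L

omit [NeZero n] in
/-- sums over the `L·n`-block offsets = sums over (coarse offset, fine offset). [folklore] -/
theorem sum_glue {β : Type*} [AddCommMonoid β] (G : (Fin d → Fin (L * n)) → β) :
    ∑ j' : Fin d → Fin (L * n), G j' = ∑ j : Fin d → Fin n, ∑ r : Fin d → Fin L, G (glue n L (j, r)) := by
  rw [← (glue_bijective (d := d) n L).sum_comp G, Fintype.sum_prod_type]

/-- **THE PARENT OF A POINT OF A REFINED CONTOUR**: the `L`-block parent of the fine point `(L·n)y + (L·j + r) + t e_μ`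
(`t` FINE steps along the straight contour from the point `L·j + r` of the `L·n`-block of `y`) is the coarse point
`n·y + j + ⌊(r_μ + t)/L⌋ e_μ` — uniformly in `t ∈ ℕ` (both tori wrap compatibly, `L ∣ L·n·M_μ`).
[cite: Balaban1984PropagatorsI, (1.6) p.18, (1.18) p.20; King1986, (2.10) p.653] [folklore] -/
theorem par_bpt_glue_add_tstep (y : Tor M) (j : Fin d → Fin n) (r : Fin d → Fin L) (μ : Fin d) (t : ℕ) :
    par n L M (bpt (L * n) M y (glue n L (j, r)) + tstep (fine (L * n) M) μ t)
      = bpt n M y j + tstep (fine n M) μ (((r μ : ℕ) + t) / L) := by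
  have hL : 0 < L := Nat.pos_of_ne_zero (NeZero.ne L)
  funext ν
  have hB : 0 < n * M ν := Nat.pos_of_ne_zero (NeZero.ne (fine n M ν))
  set δ : ℕ := if ν = μ then t else 0 with hδ
  set A : ℕ := (n * (y ν).val + (j ν : ℕ)) + ((r ν : ℕ) + δ) / L with hA
  have e1 : (L * n * (y ν).val + (L * (j ν : ℕ) + (r ν : ℕ)) + δ : ℕ) = L * A + ((r ν : ℕ) + δ) % L := by
    calc (L * n * (y ν).val + (L * (j ν : ℕ) + (r ν : ℕ)) + δ : ℕ)
        = L * (n * (y ν).val + (j ν : ℕ)) + ((r ν : ℕ) + δ) := by ring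
      _ = L * (n * (y ν).val + (j ν : ℕ)) + (L * (((r ν : ℕ) + δ) / L) + ((r ν : ℕ) + δ) % L) := by rw [Nat.div_add_mod]
      _ = L * A + ((r ν : ℕ) + δ) % L := by rw [hA]; ring
  have hX : (bpt (L * n) M y (glue n L (j, r)) + tstep (fine (L * n) M) μ t) ν
      = ((L * A + ((r ν : ℕ) + δ) % L : ℕ) : ZMod (fine (L * n) M ν)) := by
    rw [← e1, Pi.add_apply, bpt_eq_natCast, glue_val]
    simp only [tstep, hδ]
    split_ifs with h
    · push_cast; ring
    · push_cast; ring
  have hY : (bpt n M y j + tstep (fine n M) μ (((r μ : ℕ) + t) / L)) ν = ((A : ℕ) : ZMod (fine n M ν)) := by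
    rw [Pi.add_apply, bpt_eq_natCast, hA]
    simp only [tstep, hδ]
    split_ifs with h
    · subst h; push_cast; ring
    · rw [Nat.add_zero, Nat.div_eq_of_lt (r ν).isLt]; push_cast; ring
  show ((((bpt (L * n) M y (glue n L (j, r)) + tstep (fine (L * n) M) μ t) ν).val / L : ℕ) : ZMod (fine n M ν)) = _
  rw [hX, hY, ZMod.val_natCast, show fine (L * n) M ν = L * (n * M ν) from Nat.mul_assoc _ _ _,
    mod_mul_div L A _ _ hL hB (Nat.mod_lt _ hL)]
  exact ZMod.natCast_mod A (n * M ν)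

/-- King's injection plants a coarse field piecewise-constantly: `(J_L f)(x′) = √(L^d)·L^{−d}·f(par x′)`.
[cite: King1986, p.664, (2.10) p.653] [folklore] -/
theorem JK_mulVec (f : Tor (fine n M) × Fin d → ℂ) (x : Tor (fine (L * n) M) × Fin d) :
    (JK n L M *ᵥ f) x = (((Real.sqrt ((L : ℝ) ^ d)) : ℝ) : ℂ) * (((L : ℂ) ^ d)⁻¹ * f (parT n L M x)) := by
  simp only [Matrix.mulVec, dotProduct, JK_apply, mul_ite, mul_one, mul_zero, ite_mul, zero_mul]
  rw [Finset.sum_ite_eq]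
  simp [mul_assoc]

/-- the own-direction translation on fields: `(S_t f)(x, μ) = f(x + t e_μ, μ)`. [folklore] -/
theorem shiftT_mulVec (t : ℕ) (f : Tor (fine n M) × Fin d → ℂ) (i : Tor (fine n M) × Fin d) :
    (shiftT (fine n M) t *ᵥ f) i = f (i.1 + tstep (fine n M) i.2 t, i.2) := by
  simp only [Matrix.mulVec, dotProduct, shiftT, ite_mul, one_mul, zero_mul]
  rw [Finset.sum_ite_eq']
  simp

omit [NeZero n] hM in
/-- `lineSum` is additive. [folklore] -/
theorem lineSum_add (f g : Tor (fine n M) × Fin d → ℂ) (x : Tor (fine n M)) (μ : Fin d) :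
    lineSum n M (f + g) x μ = lineSum n M f x μ + lineSum n M g x μ := by
  simp only [lineSum, Pi.add_apply, sum_add_distrib]

omit [NeZero n] hM in
/-- `lineSum` is homogeneous. [folklore] -/
theorem lineSum_smul (c : ℂ) (f : Tor (fine n M) × Fin d → ℂ) (x : Tor (fine n M)) (μ : Fin d) :
    lineSum n M (c • f) x μ = c * lineSum n M f x μ := by
  simp only [lineSum, Pi.smul_apply, smul_eq_mul, mul_sum]

/-- the straight-contour sum of `S_1 f − f` TELESCOPES to the two ends of the contour: `Σ_{t<n}[f(x + (t+1)e_μ) − f(x + te_μ)]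
= f(x + n e_μ) − f(x)`. [cite: Balaban1984PropagatorsI, (1.20) p.20] [folklore] -/
theorem lineSum_shiftT_sub (f : Tor (fine n M) × Fin d → ℂ) (x : Tor (fine n M)) (μ : Fin d) :
    lineSum n M (shiftT (fine n M) 1 *ᵥ f - f) x μ = f (x + tstep (fine n M) μ n, μ) - f (x + tstep (fine n M) μ 0, μ) := by
  simp only [lineSum, Pi.sub_apply, shiftT_mulVec]
  have e : ∀ t : Fin n, f (x + tstep (fine n M) μ t + tstep (fine n M) μ 1, μ) = f (x + tstep (fine n M) μ ((t : ℕ) + 1), μ) := by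
    intro t; rw [BalabanLineAverage.tstep_one, tstep_succ, add_assoc]
  simp_rw [e]
  exact sum_fin_telescope (fun s => f (x + tstep (fine n M) μ s, μ)) n

end TwoLevels

/-! ## §2 THE PAIRING IDENTITY: `√(L^d)·Q_{L·n} J_L = Q_n (1 + c_L (S_1 − 1))` -/

section Pairing

variable (n L : ℕ) [NeZero n] [NeZero L] (M : Fin d → ℕ) [hM : ∀ μ, NeZero (M μ)]

/-- the BOUNDARY-TRANSFER COEFFICIENT `c_L = (Σ_{ρ<L} ρ)/L² = (L − 1)/(2L)`. [folklore] -/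
def cL (L : ℕ) : ℂ := (∑ ρ ∈ range L, (ρ : ℂ)) / (L : ℂ) ^ 2

/-- `c_L = (L − 1)/(2L)` (Gauss). [folklore] -/
theorem cL_eq (L : ℕ) (hL : 0 < L) : cL L = ((L : ℂ) - 1) / (2 * L) := by
  have hG : (∑ ρ ∈ range L, (ρ : ℂ)) * 2 = (L : ℂ) * ((L : ℂ) - 1) := by
    have h := Finset.sum_range_id_mul_two L
    have h' : ((∑ i ∈ range L, i : ℕ) : ℂ) * 2 = ((L * (L - 1) : ℕ) : ℂ) := by exact_mod_cast h
    rw [Nat.cast_sum, Nat.cast_mul, Nat.cast_sub hL] at h'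
    simpa using h'
  have hLc : (L : ℂ) ≠ 0 := by exact_mod_cast hL.ne'
  rw [cL, div_eq_div_iff (pow_ne_zero 2 hLc) (mul_ne_zero two_ne_zero hLc)]
  linear_combination (L : ℂ) * hG

/-- `‖c_L‖ = (L − 1)/(2L) ≤ 1/2`. [folklore] -/
theorem norm_cL_le (L : ℕ) (hL : 0 < L) : ‖cL L‖ ≤ 1 / 2 := by
  rw [cL_eq L hL]
  have hLr : (0 : ℝ) < L := by exact_mod_cast hL
  have e : ((L : ℂ) - 1) / (2 * L) = ((((L : ℝ) - 1) / (2 * L) : ℝ) : ℂ) := by push_cast; ring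
  rw [e, Complex.norm_real, Real.norm_of_nonneg (by
    apply div_nonneg _ (by positivity)
    have : (1 : ℝ) ≤ L := by exact_mod_cast hL
    linarith)]
  rw [div_le_div_iff₀ (by positivity) (by norm_num)]
  linarith

/-- **THE PAIRING IDENTITY** (exact, every `n, L ≥ 1`, torus `M`, dimension `d`): Bałaban's `(L·n)`-fold (1.18)-average of
the piecewise-constant `L`-block extension (King's injection `J_L = √(L^d)·Q_Lᴴ`) of a level-`n` field is its `n`-fold
(1.18)-average PLUS the boundary transfer `c_L·Q_n(S_1 − 1)`:
`√(L^d)·Q_{L·n} J_L = Q_n·(1 + c_L(S_1 − 1))`, `c_L = (L−1)/(2L)`, `(S_1 f)(x, μ) = f(x + e_μ, μ)`.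
(The straight contours of (1.18) make the pairing INEXACT — for King's own average `Q_L` it is exact,
`KingPairingPlantedLaw.sqrt_smul_Qavg_mul_JK`.)  Statement and proof OURS. [cite: Balaban1984PropagatorsI, (1.18) p.20;
King1986, p.664, (2.10) p.653] [folklore] -/
theorem sqrt_smul_QvOp_mul_JK :
    ((((Real.sqrt ((L : ℝ) ^ d)) : ℝ) : ℂ)) • (QvOp (L * n) M * JK n L M)
      = QvOp n M * (1 + cL L • (shiftT (fine n M) 1 - 1)) := by
  have hL : 0 < L := Nat.pos_of_ne_zero (NeZero.ne L)
  have hLc : (L : ℂ) ≠ 0 := by exact_mod_cast hL.ne'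
  have hnc : (n : ℂ) ≠ 0 := by exact_mod_cast NeZero.ne n
  obtain ⟨_, hss⟩ := KingPairingPlantedLaw.sqrt_facts (d := d) L
  rw [Matrix.ext_iff_mulVec]
  intro f
  funext b
  obtain ⟨y, μ⟩ := b
  set F : (Fin d → Fin n) → ℕ → ℂ := fun j s => f (bpt n M y j + tstep (fine n M) μ s, μ) with hF
  have key : ∀ j : Fin d → Fin n,
      (L : ℂ) * ∑ r : Fin d → Fin L, ∑ t : Fin (L * n),
          f (par n L M (bpt (L * n) M y (glue n L (j, r)) + tstep (fine (L * n) M) μ t), μ)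
        = (L : ℂ) ^ d * ((L : ℂ) ^ 2 * ∑ s ∈ range n, F j s + (∑ ρ ∈ range L, (ρ : ℂ)) * (F j n - F j 0)) := by
    intro j
    simp_rw [par_bpt_glue_add_tstep]
    have e1 : ∀ r : Fin d → Fin L, ∑ t : Fin (L * n), f (bpt n M y j + tstep (fine n M) μ (((r μ : ℕ) + t) / L), μ)
        = ∑ t ∈ range (L * n), F j (((r μ : ℕ) + t) / L) := fun r =>
      Fin.sum_univ_eq_sum_range (fun t => F j (((r μ : ℕ) + t) / L)) (L * n)
    simp_rw [e1]
    rw [sum_fun_coord L μ (fun ρ : Fin L => ∑ t ∈ range (L * n), F j (((ρ : ℕ) + t) / L)),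
      Fin.sum_univ_eq_sum_range (fun ρ => ∑ t ∈ range (L * n), F j ((ρ + t) / L)) L, tent_count (F j) L n hL]
  have key' : ∀ j : Fin d → Fin n,
      ∑ r : Fin d → Fin L, ∑ t : Fin (L * n),
          f (par n L M (bpt (L * n) M y (glue n L (j, r)) + tstep (fine (L * n) M) μ t), μ)
        = (L : ℂ) ^ d * ((L : ℂ) ^ 2 * ∑ s ∈ range n, F j s + (∑ ρ ∈ range L, (ρ : ℂ)) * (F j n - F j 0)) / L := by
    intro j
    rw [eq_div_iff hLc, mul_comm, key j]
  -- the left side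
  rw [Matrix.smul_mulVec, ← Matrix.mulVec_mulVec, Pi.smul_apply, smul_eq_mul, QvOp_mulVec]
  simp only [lineSum, JK_mulVec, parT, ← Finset.mul_sum]
  rw [sum_glue n L (fun j' => ∑ t : Fin (L * n), f (par n L M (bpt (L * n) M y j' + tstep (fine (L * n) M) μ t), μ))]
  simp_rw [key']
  -- the right side
  rw [← Matrix.mulVec_mulVec, Matrix.add_mulVec, Matrix.one_mulVec, Matrix.smul_mulVec, Matrix.sub_mulVec,
    Matrix.one_mulVec, QvOp_mulVec]
  simp only [lineSum_add, lineSum_smul, lineSum_shiftT_sub]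
  have e2 : ∀ j : Fin d → Fin n, lineSum n M f (bpt n M y j) μ = ∑ s ∈ range n, F j s := fun j =>
    Fin.sum_univ_eq_sum_range (fun s => F j s) n
  simp_rw [e2]
  simp only [hF]
  set sq : ℂ := (((Real.sqrt ((L : ℝ) ^ d)) : ℝ) : ℂ) with hsq
  have hre : ∀ A B : ℂ, sq * (A * (sq * B)) = (sq * sq) * (A * B) := fun A B => by ring
  rw [hre, hss]
  have hS : ∑ x : Fin d → Fin n, (L : ℂ) ^ d * ((L : ℂ) ^ 2 * ∑ s ∈ range n, f (bpt n M y x + tstep (fine n M) μ s, μ)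
        + (∑ ρ ∈ range L, (ρ : ℂ)) * (f (bpt n M y x + tstep (fine n M) μ n, μ) - f (bpt n M y x + tstep (fine n M) μ 0, μ))) / L
      = (L : ℂ) ^ (d + 1) * ∑ x : Fin d → Fin n, (∑ s ∈ range n, f (bpt n M y x + tstep (fine n M) μ s, μ)
        + cL L * (f (bpt n M y x + tstep (fine n M) μ n, μ) - f (bpt n M y x + tstep (fine n M) μ 0, μ))) := by
    rw [Finset.mul_sum]
    refine Finset.sum_congr rfl fun x _ => ?_
    rw [cL]
    field_simp
    ring
  rw [hS]
  push_cast
  field_simp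
  ring

end Pairing

end Summit.QuantumFields.BalabanUV.T4Continuum.LineAveragingPairing

end
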